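import Summits.Ventures.DiscreteObjects.PP12.Involution

/-!
# Counting tools for the order-3 cell of PP(12): two/three fixed lines, off-line bounds, value bookkeeping, arithmetic core
Framing: lottery ticket; floor = certified bounds/negative ranges.

Support file for `OrderThree.lean` (cell pub-namedobj, target M; the live `|G| = 3` cell of a putative projective plane of
order 12). General-order lemmas for a collineation `σ` of a finite projective plane (Mathlib `Configuration.ProjectivePlane`),
with `f` = number of fixed points, `k_m` = number of fixed points on the line `m`:

* `fixedOnLine_add_le_of_ne` — two distinct lines: `k_m + k_m' ≤ f + 1` (they share at most one point);
* `fixedOnLine_add_add_le` — three pairwise distinct lines: `k_m + k_m' + k_m'' ≤ f + 3`;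
* `fixedCard_le_fixedOnLine_add_order` — a fixed line `m` with a non-fixed point: `f ≤ k_m + n` (from `FixedOffLineBound`),
  and its dual `fixedCard_lines_le_fixedThrough_add_order`;
* `sum_vals_one_four_seven_ten` — bookkeeping: if every value of `g` on `s` lies in `{1,4,7,10}` then `Σ g`, `Σ g²` and `#s`
  are the obvious combinations of the four multiplicities;
* `order3_arith` — the finite arithmetic: the multiplicities `a₁,a₄,a₇,a₁₀` (fixed lines by number of fixed points) and
  `b₁,b₄,b₇,b₁₀` (fixed points by number of fixed lines) of a collineation of order 3 of PP(12) with no axis satisfy either the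
  PLANAR pattern (`f = g = 13`, all values `4`) or the GENERALIZED-ELATION pattern (one line carries all `f ∈ {1,4,7,10}` fixed
  points, one point carries all `g ∈ {1,4,7,10}` fixed lines). The hypotheses are exactly: flag count, point-pair count,
  line-pair count, `f ≡ g ≡ 1 (mod 3)`, the off-line bounds `f ≤ 12 + k`, `g ≤ 12 + t`, and the two/three-line inequalities
  in the three instances that are needed (`10+7 ≤ f+1`, `7+4+4 ≤ f+3`, `7+7+4 ≤ f+3`). That this hypothesis set leaves exactly
  these solutions was first found by exhaustive enumeration (designs g4 `work/enum3*.py`); here `omega` re-derives it after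
  `interval_cases` on `f, g ≤ 22`.
-/

namespace Summit.Ventures.DiscreteObjects.PP12

open Configuration Finset
open scoped Classical

namespace Collineation

variable {P L : Type*} [Membership P L] [ProjectivePlane P L] [Fintype P] [Fintype L]
  [DecidableEq P] [DecidableEq L] (σ : Collineation P L)

/-! ### Two and three lines -/

omit [Fintype P] [Fintype L] [DecidableEq P] [DecidableEq L] in
/-- Two distinct lines have at most one common point inside any set of points. -/
theorem card_filter_mem_mem_le_one {m₁ m₂ : L} (hne : m₁ ≠ m₂) (s : Finset P) :
    (s.filter fun x => x ∈ m₁ ∧ x ∈ m₂).card ≤ 1 := by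
  refine Finset.card_le_one.mpr fun a ha b hb => ?_
  simp only [mem_filter] at ha hb
  exact (Nondegenerate.eq_or_eq ha.2.1 hb.2.1 ha.2.2 hb.2.2).resolve_right hne

omit [ProjectivePlane P L] [Fintype L] [DecidableEq L] in
/-- `fixedOnLine m` as the number of fixed points lying on `m`. -/
theorem fixedOnLine_eq_card_filter (m : L) :
    σ.fixedOnLine m = ((univ.filter fun x : P => σ.onPoints x = x).filter fun x => x ∈ m).card := by
  unfold fixedOnLine; congr 1; ext x; simp [and_comm]

omit [Fintype L] [DecidableEq L] in
/-- **Two lines.** For distinct lines `m₁ ≠ m₂`: `k_{m₁} + k_{m₂} ≤ f + 1`. -/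
theorem fixedOnLine_add_le_of_ne {m₁ m₂ : L} (hne : m₁ ≠ m₂) :
    σ.fixedOnLine m₁ + σ.fixedOnLine m₂ ≤ fixedCard σ.onPoints + 1 := by
  set S : Finset P := univ.filter fun x : P => σ.onPoints x = x with hS
  have hSdef : fixedCard σ.onPoints = S.card := rfl
  rw [σ.fixedOnLine_eq_card_filter m₁, σ.fixedOnLine_eq_card_filter m₂, hSdef]
  set A := S.filter fun x => x ∈ m₁
  set B := S.filter fun x => x ∈ m₂
  have h1 := Finset.card_union_add_card_inter A B
  have h2 : (A ∪ B).card ≤ S.card :=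
    Finset.card_le_card (Finset.union_subset (Finset.filter_subset _ _) (Finset.filter_subset _ _))
  have h3 : (A ∩ B).card ≤ 1 := by
    have : A ∩ B = S.filter fun x => x ∈ m₁ ∧ x ∈ m₂ := by
      ext x; simp only [A, B, mem_inter, mem_filter]; tauto
    rw [this]; exact card_filter_mem_mem_le_one hne S
  omega

omit [Fintype L] [DecidableEq L] in
/-- **Three lines.** For pairwise distinct lines: `k₁ + k₂ + k₃ ≤ f + 3`. -/
theorem fixedOnLine_add_add_le {m₁ m₂ m₃ : L} (h12 : m₁ ≠ m₂) (h13 : m₁ ≠ m₃) (h23 : m₂ ≠ m₃) :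
    σ.fixedOnLine m₁ + σ.fixedOnLine m₂ + σ.fixedOnLine m₃ ≤ fixedCard σ.onPoints + 3 := by
  set S : Finset P := univ.filter fun x : P => σ.onPoints x = x with hS
  have hSdef : fixedCard σ.onPoints = S.card := rfl
  rw [σ.fixedOnLine_eq_card_filter m₁, σ.fixedOnLine_eq_card_filter m₂, σ.fixedOnLine_eq_card_filter m₃, hSdef]
  set A := S.filter fun x => x ∈ m₁
  set B := S.filter fun x => x ∈ m₂
  set C := S.filter fun x => x ∈ m₃
  have hAB := Finset.card_union_add_card_inter A B
  have hABC := Finset.card_union_add_card_inter (A ∪ B) C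
  have hle : (A ∪ B ∪ C).card ≤ S.card :=
    Finset.card_le_card (Finset.union_subset (Finset.union_subset (Finset.filter_subset _ _)
      (Finset.filter_subset _ _)) (Finset.filter_subset _ _))
  have hi : ∀ {X Y : Finset P} {n₁ n₂ : L}, n₁ ≠ n₂ → X = S.filter (fun x => x ∈ n₁) → Y = S.filter (fun x => x ∈ n₂) →
      (X ∩ Y).card ≤ 1 := by
    intro X Y n₁ n₂ hn hX hY
    have : X ∩ Y = S.filter fun x => x ∈ n₁ ∧ x ∈ n₂ := by
      ext x; simp only [hX, hY, mem_inter, mem_filter]; tauto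
    rw [this]; exact card_filter_mem_mem_le_one hn S
  have h1 : (A ∩ B).card ≤ 1 := hi h12 rfl rfl
  have h2 : (A ∩ C).card ≤ 1 := hi h13 rfl rfl
  have h3 : (B ∩ C).card ≤ 1 := hi h23 rfl rfl
  have h4 : ((A ∪ B) ∩ C).card ≤ 2 := by
    have hsub : (A ∪ B) ∩ C ⊆ (A ∩ C) ∪ (B ∩ C) := by
      intro x hx
      simp only [mem_inter, mem_union] at hx ⊢
      tauto
    exact (Finset.card_le_card hsub).trans ((Finset.card_union_le _ _).trans (by omega))
  omega

omit [Fintype P] [DecidableEq P] in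
/-- **Two points** (dual): for distinct points, `t_{p₁} + t_{p₂} ≤ g + 1` (`g` = number of fixed lines). -/
theorem fixedThrough_add_le_of_ne {p₁ p₂ : P} (hne : p₁ ≠ p₂) :
    σ.fixedThrough p₁ + σ.fixedThrough p₂ ≤ fixedCard σ.onLines + 1 := by
  rw [fixedThrough_eq_dual, fixedThrough_eq_dual]
  exact σ.dual.fixedOnLine_add_le_of_ne (m₁ := (p₁ : Dual P)) (m₂ := (p₂ : Dual P)) hne

omit [Fintype P] [DecidableEq P] in
/-- **Three points** (dual): for pairwise distinct points, `t₁ + t₂ + t₃ ≤ g + 3`. -/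
theorem fixedThrough_add_add_le {p₁ p₂ p₃ : P} (h12 : p₁ ≠ p₂) (h13 : p₁ ≠ p₃) (h23 : p₂ ≠ p₃) :
    σ.fixedThrough p₁ + σ.fixedThrough p₂ + σ.fixedThrough p₃ ≤ fixedCard σ.onLines + 3 := by
  rw [fixedThrough_eq_dual, fixedThrough_eq_dual, fixedThrough_eq_dual]
  exact σ.dual.fixedOnLine_add_add_le (m₁ := (p₁ : Dual P)) (m₂ := (p₂ : Dual P)) (m₃ := (p₃ : Dual P)) h12 h13 h23

/-! ### Off-line bounds -/

omit [DecidableEq L] in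
/-- **Off-line bound.** If the fixed line `m` is not pointwise fixed then `f ≤ k_m + n`. -/
theorem fixedCard_le_fixedOnLine_add_order {m : L} (hm : σ.onLines m = m)
    (hk : σ.fixedOnLine m < ProjectivePlane.order P L + 1) :
    fixedCard σ.onPoints ≤ σ.fixedOnLine m + ProjectivePlane.order P L := by
  set S : Finset P := univ.filter fun x : P => σ.onPoints x = x with hS
  have hSdef : fixedCard σ.onPoints = S.card := rfl
  have hlpts : (univ.filter fun x : P => x ∈ m).card = ProjectivePlane.order P L + 1 := by
    rw [← ProjectivePlane.pointCount_eq P m, Configuration.pointCount, Nat.card_eq_fintype_card,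
      Fintype.card_subtype]
  obtain ⟨X, hXm, hXnot⟩ : ∃ X : P, X ∈ m ∧ σ.onPoints X ≠ X := by
    by_contra h
    push Not at h
    have hsub : (univ.filter fun x : P => x ∈ m) ⊆ univ.filter fun x => x ∈ m ∧ σ.onPoints x = x :=
      fun x hx => by simp only [mem_filter, mem_univ, true_and] at hx ⊢; exact ⟨hx, h x hx⟩
    have := Finset.card_le_card hsub
    unfold fixedOnLine at hk
    rw [hlpts] at this
    omega
  have hoff := σ.card_fixed_off_line_le_order hm hXm hXnot
  have hon : (S.filter fun x => x ∈ m).card = σ.fixedOnLine m := (σ.fixedOnLine_eq_card_filter m).symm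
  have hsplit := Finset.card_filter_add_card_filter_not (s := S) (fun x : P => x ∈ m)
  have hoff' : (S.filter fun x => x ∉ m).card ≤ ProjectivePlane.order P L := by
    convert hoff using 2; ext x; simp [hS]
  omega

omit [DecidableEq P] in
/-- **Dual off-line bound.** If not every line through the fixed point `p` is fixed then `g ≤ t_p + n`. -/
theorem fixedCard_lines_le_fixedThrough_add_order {p : P} (hp : σ.onPoints p = p)
    (ht : σ.fixedThrough p < ProjectivePlane.order P L + 1) :
    fixedCard σ.onLines ≤ σ.fixedThrough p + ProjectivePlane.order P L := by
  rw [fixedThrough_eq_dual] at ht ⊢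
  rw [← ProjectivePlane.Dual.order P L] at ht ⊢
  exact σ.dual.fixedCard_le_fixedOnLine_add_order (m := (p : Dual P)) hp ht

/-! ### Bookkeeping for values in `{1, 4, 7, 10}` -/

/-- If `g` takes only the values `1, 4, 7, 10` on `s`, then `Σ g`, `Σ g²` and `#s` are determined by the four multiplicities. -/
theorem sum_vals_one_four_seven_ten {α : Type*} (s : Finset α) (g : α → ℕ)
    (h : ∀ x ∈ s, g x = 1 ∨ g x = 4 ∨ g x = 7 ∨ g x = 10) :
    ∑ x ∈ s, g x = (s.filter fun x => g x = 1).card + 4 * (s.filter fun x => g x = 4).card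
        + 7 * (s.filter fun x => g x = 7).card + 10 * (s.filter fun x => g x = 10).card ∧
    ∑ x ∈ s, g x ^ 2 = (s.filter fun x => g x = 1).card + 16 * (s.filter fun x => g x = 4).card
        + 49 * (s.filter fun x => g x = 7).card + 100 * (s.filter fun x => g x = 10).card ∧
    (s.filter fun x => g x = 1).card + (s.filter fun x => g x = 4).card
        + (s.filter fun x => g x = 7).card + (s.filter fun x => g x = 10).card = s.card := by
  set t : Finset ℕ := {1, 4, 7, 10} with ht
  have hmaps : ∀ x ∈ s, g x ∈ t := by
    intro x hx
    rcases h x hx with e | e | e | e <;> simp [ht, e]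
  have hval : ∀ j : ℕ, ∑ x ∈ s.filter (fun x => g x = j), g x = (s.filter fun x => g x = j).card * j := fun j =>
    Finset.sum_const_nat fun x hx => (Finset.mem_filter.mp hx).2
  have hval2 : ∀ j : ℕ, ∑ x ∈ s.filter (fun x => g x = j), g x ^ 2 = (s.filter fun x => g x = j).card * j ^ 2 :=
    fun j => Finset.sum_const_nat fun x hx => by rw [(Finset.mem_filter.mp hx).2]
  have e1 := Finset.sum_fiberwise_of_maps_to hmaps (fun x => g x)
  have e2 := Finset.sum_fiberwise_of_maps_to hmaps (fun x => g x ^ 2)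
  have e3 := Finset.card_eq_sum_card_fiberwise hmaps
  rw [ht] at e1 e2 e3
  rw [Finset.sum_insert (by decide), Finset.sum_insert (by decide), Finset.sum_insert (by decide),
    Finset.sum_singleton] at e1 e2 e3
  simp only [hval] at e1
  simp only [hval2] at e2
  refine ⟨?_, ?_, ?_⟩
  · rw [← e1]; ring
  · rw [← e2]; ring
  · rw [e3]; omega

/-! ### The arithmetic core -/

/-- **One side of the arithmetic** (fixed lines by their number of fixed points `∈ {1,4,7,10}`, multiplicities `a₄, a₇, a₁₀`;
or dually fixed points by their number of fixed lines). Hypotheses: pair count `12a₄ + 42a₇ + 90a₁₀ = f(f−1)`,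
`f ≡ 1 (mod 3)`, `f ≤ 22`, the off-line bounds for values `4, 7`, and seven instances of the two/three-line inequalities.
Conclusion: the planar pattern, two spurious patterns at `f = 16` (killed by the other side in `order3_arith`), or the
generalized-elation pattern. -/
theorem order3_arith_side (a₄ a₇ a₁₀ f : ℕ) (hP : 12 * a₄ + 42 * a₇ + 90 * a₁₀ = f * (f - 1)) (hf3 : f % 3 = 1)
    (hf22 : f ≤ 22) (hB : (1 ≤ a₄ → f ≤ 16) ∧ (1 ≤ a₇ → f ≤ 19))
    (hF : (1 ≤ a₁₀ → 1 ≤ a₇ → 16 ≤ f) ∧ (2 ≤ a₁₀ → 19 ≤ f) ∧ (1 ≤ a₇ → 2 ≤ a₄ → 12 ≤ f) ∧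
      (2 ≤ a₇ → 1 ≤ a₄ → 15 ≤ f) ∧ (3 ≤ a₇ → 18 ≤ f) ∧ (1 ≤ a₁₀ → 2 ≤ a₇ → 21 ≤ f) ∧
      (1 ≤ a₁₀ → 1 ≤ a₇ → 1 ≤ a₄ → 18 ≤ f)) :
    (f = 13 ∧ a₄ = 13 ∧ a₇ = 0 ∧ a₁₀ = 0) ∨ (f = 16 ∧ a₄ = 13 ∧ a₇ = 2 ∧ a₁₀ = 0) ∨
    (f = 16 ∧ a₄ = 20 ∧ a₇ = 0 ∧ a₁₀ = 0) ∨ (f ≤ 10 ∧ a₄ + a₇ + a₁₀ ≤ 1 ∧ 3 * a₄ + 6 * a₇ + 9 * a₁₀ + 1 = f) := by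
  obtain ⟨hB1, hB2⟩ := hB
  obtain ⟨hF1, hF2, hF3, hF4, hF5, hF6, hF7⟩ := hF
  have hfc : f = 1 ∨ f = 4 ∨ f = 7 ∨ f = 10 ∨ f = 13 ∨ f = 16 ∨ f = 19 ∨ f = 22 := by omega
  clear hf3 hf22
  rcases hfc with rfl | rfl | rfl | rfl | rfl | rfl | rfl | rfl <;>
    (try norm_num at hB1 hB2 hF1 hF2 hF3 hF4 hF5 hF6 hF7 hP ⊢) <;> omega

/-- **Arithmetic core of the order-3 classification**: combining the two sides with the flag count. Conclusion: planar
pattern (`f = g = 13`, only the value `4` occurs) or generalized-elation pattern (`f, g ≤ 10`, at most one line with `≥ 4`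
fixed points and it carries all `f`, at most one point with `≥ 4` fixed lines and it carries all `g`). -/
theorem order3_arith (a₁ a₄ a₇ a₁₀ b₁ b₄ b₇ b₁₀ f g : ℕ)
    (hg : a₁ + a₄ + a₇ + a₁₀ = g) (hf : b₁ + b₄ + b₇ + b₁₀ = f)
    (hflag : a₁ + 4 * a₄ + 7 * a₇ + 10 * a₁₀ = b₁ + 4 * b₄ + 7 * b₇ + 10 * b₁₀)
    (hA : (f = 13 ∧ a₄ = 13 ∧ a₇ = 0 ∧ a₁₀ = 0) ∨ (f = 16 ∧ a₄ = 13 ∧ a₇ = 2 ∧ a₁₀ = 0) ∨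
      (f = 16 ∧ a₄ = 20 ∧ a₇ = 0 ∧ a₁₀ = 0) ∨ (f ≤ 10 ∧ a₄ + a₇ + a₁₀ ≤ 1 ∧ 3 * a₄ + 6 * a₇ + 9 * a₁₀ + 1 = f))
    (hBs : (g = 13 ∧ b₄ = 13 ∧ b₇ = 0 ∧ b₁₀ = 0) ∨ (g = 16 ∧ b₄ = 13 ∧ b₇ = 2 ∧ b₁₀ = 0) ∨
      (g = 16 ∧ b₄ = 20 ∧ b₇ = 0 ∧ b₁₀ = 0) ∨ (g ≤ 10 ∧ b₄ + b₇ + b₁₀ ≤ 1 ∧ 3 * b₄ + 6 * b₇ + 9 * b₁₀ + 1 = g))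
    (hB1 : 1 ≤ a₁ → f ≤ 13) (hB2 : 1 ≤ b₁ → g ≤ 13) :
    (f = 13 ∧ g = 13 ∧ a₁ = 0 ∧ a₇ = 0 ∧ a₁₀ = 0 ∧ b₁ = 0 ∧ b₇ = 0 ∧ b₁₀ = 0) ∨
    (f ≤ 10 ∧ g ≤ 10 ∧ a₄ + a₇ + a₁₀ ≤ 1 ∧ 3 * a₄ + 6 * a₇ + 9 * a₁₀ + 1 = f ∧
      b₄ + b₇ + b₁₀ ≤ 1 ∧ 3 * b₄ + 6 * b₇ + 9 * b₁₀ + 1 = g) := by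
  rcases hA with ⟨rfl, rfl, rfl, rfl⟩ | ⟨rfl, rfl, rfl, rfl⟩ | ⟨rfl, rfl, rfl, rfl⟩ | ⟨hf10, ha1, ha2⟩ <;>
    rcases hBs with ⟨rfl, rfl, rfl, rfl⟩ | ⟨rfl, rfl, rfl, rfl⟩ | ⟨rfl, rfl, rfl, rfl⟩ | ⟨hg10, hb1, hb2⟩ <;> omega

end Collineation

end Summit.Ventures.DiscreteObjects.PP12
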